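import Summits.NavierStokesRegularity.NavierStokesRegularity.Theorems.TypeILiouvilleTypeIliouvilleNoTypeIIRateCovering
import Summits.NavierStokesRegularity.NavierStokesRegularity.Theorems.TypeILiouvilleTypeIliouvilleNoTypeIIDoorCalculus
import HarnessLib

/-!
# «Type-I rate at most times» is a costume of `NoTypeII` — the tautology certificate
# (crux `TypeIliouvilleNoTypeII`, stmt-NavierStokesRegularity-0056; §B keep/kill calibration)

The file `…RateCovering` proved KILL for the clause
`D_mt ν T u p := ∃ C > 0, ∃ B ⊆ ℝ, ‖u(s,·)‖ ≤ C/√(T − s) at every s ∈ [0,T) ∖ B, B of final density 0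
at T` («the self-similar rate off a null-density set of times»): `D_mt ⇒ IsTypeIBlowup u T`
(`isTypeIBlowup_of_rate_off_nullDensity_set`, Leray's doubling time).  NECESSITY is immediate (a Type-I
blow-up satisfies `D_mt` with `B` = the early times).  Feeding both into ns-typeII-p1's door calculus
(`blowupClause_iff_typeIliouvilleNoTypeII`) gives the kernel certificate

  `rateOffNullDensitySet_iff_typeIliouvilleNoTypeII : (∀ blow-ups, D_mt) ↔ NoTypeII`.

Reading for the §B critics (K1/K2): any candidate estimate whose conclusion is the sup-rate on a set
of times of full final density — «Type I at most times», «Type I along every/some parabolically dense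
sequence», «Type I at geometric checkpoints» — is EQUIVALENT to the hard core 0056, not a weakening of
it: on the Type-II side the time axis buys nothing (the Type-II-side twin of the T2 print map's (F1)).
Nothing here bears on regularity or blow-up. [folklore]
-/

noncomputable section

-- the summit and its single problem share the name `NavierStokesRegularity` (D-0017 nested layout)
set_option linter.dupNamespace false

open Set Filter Topology MeasureTheory
open scoped ENNReal

namespace Summit.NavierStokesRegularity.NavierStokesRegularity.Theorems.TypeIliouvilleNoTypeII.RateCovering

open Literature.Analysis Literature.Analysis.FluidPDE
open Summit.NavierStokesRegularity.NavierStokesRegularity.Theorems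

/-- **NECESSITY.**  A Type-I blow-up obeys the rate off a null-density set of times (indeed off the
set of EARLY times only: with `‖u(t,·)‖ ≤ C/√(T − t)` for `t ∈ (t₁, T)`, take `B = (−∞, t₁]`, which
misses `(T − h, T)` for `h ≤ T − t₁`). [folklore] -/
theorem rateOffNullDensitySet_of_isTypeIBlowup {T : ℝ} (hT : 0 < T)
    {u : ℝ → EuclideanSpace ℝ (Fin 3) → EuclideanSpace ℝ (Fin 3)} (hI : IsTypeIBlowup u T) :
    ∃ (C : ℝ) (B : Set ℝ), 0 < C ∧
      (∀ s ∈ Ico 0 T, s ∉ B → ∀ x, ‖u s x‖ ≤ C / Real.sqrt (T - s)) ∧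
      (∀ δ : ℝ, 0 < δ →
        ∀ᶠ h in 𝓝[>] (0 : ℝ), volume (B ∩ Ioo (T - h) T) ≤ ENNReal.ofReal (δ * h)) := by
  obtain ⟨C, hC⟩ := hI
  -- a left neighbourhood `(t₁, T)` on which the rate holds
  obtain ⟨t₁, ht₁T, ht₁⟩ := (mem_nhdsLT_iff_exists_Ioo_subset).1 hC
  -- enlarge the constant to make it positive
  refine ⟨max C 1, Iic (max t₁ 0), lt_of_lt_of_le one_pos (le_max_right _ _), ?_, ?_⟩
  · intro s hs hsB x
    have hs1 : max t₁ 0 < s := not_le.1 hsB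
    have hrate := ht₁ ⟨lt_of_le_of_lt (le_max_left _ _) hs1, hs.2⟩ x
    have hsq : 0 < Real.sqrt (T - s) := Real.sqrt_pos.2 (sub_pos.2 hs.2)
    exact hrate.trans (div_le_div_of_nonneg_right (le_max_left _ _) hsq.le)
  · intro δ hδ
    have hgap : 0 < T - max t₁ 0 := sub_pos.2 (max_lt ht₁T hT)
    filter_upwards [Ioo_mem_nhdsGT hgap] with h hh
    have hempty : Iic (max t₁ 0) ∩ Ioo (T - h) T = ∅ := by
      ext s
      simp only [mem_inter_iff, mem_Iic, mem_Ioo, mem_empty_iff_false, iff_false, not_and, not_lt]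
      intro hs hs'
      linarith [hh.2]
    rw [hempty, measure_empty]
    exact zero_le

/-- **TAUTOLOGY CERTIFICATE for «Type-I rate at most times».**  The candidate «every maximal classical
Leray–Hopf solution from a rapidly decaying datum obeys the self-similar rate, for some constant, off a
set of times of final density zero» is EQUIVALENT to the hard core `TypeIliouvilleNoTypeII`
(stmt-NavierStokesRegularity-0056): KILL is `isTypeIBlowup_of_rate_off_nullDensity_set` (Leray's
doubling time), NECESSITY is `rateOffNullDensitySet_of_isTypeIBlowup`, and the equivalence is
ns-typeII-p1's certificate `blowupClause_iff_typeIliouvilleNoTypeII`. [folklore] -/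
theorem rateOffNullDensitySet_iff_typeIliouvilleNoTypeII :
    (∀ (ν T : ℝ), 0 < ν → 0 < T →
      ∀ (u : ℝ → EuclideanSpace ℝ (Fin 3) → EuclideanSpace ℝ (Fin 3))
        (p : ℝ → EuclideanSpace ℝ (Fin 3) → ℝ),
      IsMaximalSmoothSolution ν 0 u p T → IsLerayHopfOn T ν 0 (u 0) u → HasRapidSpatialDecay (u 0) →
      ∃ (C : ℝ) (B : Set ℝ), 0 < C ∧
        (∀ s ∈ Ico 0 T, s ∉ B → ∀ x, ‖u s x‖ ≤ C / Real.sqrt (T - s)) ∧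
        (∀ δ : ℝ, 0 < δ →
          ∀ᶠ h in 𝓝[>] (0 : ℝ), volume (B ∩ Ioo (T - h) T) ≤ ENNReal.ofReal (δ * h))) ↔
    Summit.NavierStokesRegularity.NavierStokesRegularity.Theses.TypeILiouville.TypeIliouvilleNoTypeII :=
  blowupClause_iff_typeIliouvilleNoTypeII
    (D := fun ν T u _ => ∃ (C : ℝ) (B : Set ℝ), 0 < C ∧
        (∀ s ∈ Ico 0 T, s ∉ B → ∀ x, ‖u s x‖ ≤ C / Real.sqrt (T - s)) ∧
        (∀ δ : ℝ, 0 < δ →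
          ∀ᶠ h in 𝓝[>] (0 : ℝ), volume (B ∩ Ioo (T - h) T) ≤ ENNReal.ofReal (δ * h)))
    (fun ν T hν hT u p hmax hLH _ hD => by
      obtain ⟨C, B, hC, hrate, hnull⟩ := hD
      exact isTypeIBlowup_of_rate_off_nullDensity_set hν hT hmax.1 hLH hC hrate hnull)
    (fun ν T _ hT u p _ _ _ hI => rateOffNullDensitySet_of_isTypeIBlowup hT hI)

end Summit.NavierStokesRegularity.NavierStokesRegularity.Theorems.TypeIliouvilleNoTypeII.RateCovering

end
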